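import Literature.NumberTheory.CubicFields.StabilizerFinite
import Mathlib.FieldTheory.Galois.Basic
import Mathlib.GroupTheory.Coset.Card
import HarnessLib

/-!
# `|Stab(f)| ∈ {1, 3}` for irreducible `f`: `|Aut R| ∣ |Aut K| ∣ [K : ℚ] = 3` (BTT (29))

Topic `Literature/NumberTheory/CubicFields`; sharpening `StabilizerFinite.lean` (`|Stab(f)| ≤ 3` for
irreducible `f`, via `Aut R(f) ↪ Aut K_f`).

Bhargava–Taniguchi–Thorne 2023, §4.1 (29): "`|Aut(F)| = 1` if `F` is a non-Galois cubic field,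
`3` if `F` is a Galois cubic field." For an arbitrary order `R(f)` of the cubic field `K_f`
(`f` irreducible) the automorphism group embeds in `Aut(K_f)`, whose order divides `[K_f : ℚ] = 3`
(Artin: `[K : K^G] = |G|`), so:

* `RingOfForm.card_algEquiv_dvd_three` — `|Aut_ℚ(K_f)| ∣ 3`;
* `RingOfForm.card_ringAut_dvd_three`, **`card_ringAut_eq_one_or_three`** — `|Aut R(f)| ∈ {1, 3}`;
* **`card_stabilizer_eq_one_or_three`**, `card_stabilizer_ne_two` — `|Stab_{GL₂(ℤ)}(f)| ∈ {1, 3}`: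
  the Shintani weight of an irreducible orbit is exactly `1` or `1/3`.

## References

* M. Bhargava, T. Taniguchi, F. Thorne, *Improved error estimates for the Davenport–Heilbronn
  theorems*, Math. Ann. 389 (2024) = arXiv:2107.12819, §4.1 (29) [BhargavaTaniguchiThorne2023].
-/

namespace Literature.NumberTheory.CubicFields

namespace RingOfForm

open BinaryCubic IntermediateField

variable {f : BinaryCubic ℤ} [hf : Fact f.IsIrreducible]

/-- **`|Aut_ℚ(K)| ∣ [K : ℚ] = 3`** for the cubic field `K = K_f` (Artin's theorem
`[K : K^{Aut K}] = |Aut K|` and the tower law). [folklore] -/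
theorem card_algEquiv_dvd_three : Nat.card (RatAlgebra f ≃ₐ[ℚ] RatAlgebra f) ∣ 3 := by
  have h1 : Module.finrank (fixedField (⊤ : Subgroup (RatAlgebra f ≃ₐ[ℚ] RatAlgebra f))) (RatAlgebra f) =
      Nat.card (RatAlgebra f ≃ₐ[ℚ] RatAlgebra f) := by
    rw [finrank_fixedField_eq_card, Subgroup.card_top]
  have h2 := Module.finrank_mul_finrank ℚ (fixedField (⊤ : Subgroup (RatAlgebra f ≃ₐ[ℚ] RatAlgebra f))) (RatAlgebra f)
  rw [h1, finrank_ratAlgebra_eq_three] at h2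
  exact Dvd.intro_left _ h2

/-- Ring automorphisms and `ℚ`-algebra automorphisms of `K_f` are the same thing. [folklore] -/
noncomputable def ringAutEquivAlgEquiv (f : BinaryCubic ℤ) [Fact f.IsIrreducible] :
    RingAut (RatAlgebra f) ≃ (RatAlgebra f ≃ₐ[ℚ] RatAlgebra f) where
  toFun := fieldAutToAlgEquiv f
  invFun e := e.toRingEquiv
  left_inv e := by ext x; rfl
  right_inv e := by ext x; rfl

/-- `|Aut R(f)| ∣ 3`: `Aut R(f) ↪ Aut K_f` is an injective group homomorphism. [folklore] -/
theorem card_ringAut_dvd_three : Nat.card (RingAut (RingOfForm f)) ∣ 3 := by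
  have h := Subgroup.card_dvd_of_injective (ringAutToFieldAut f) ringAutToFieldAut_injective
  rw [Nat.card_congr (ringAutEquivAlgEquiv f)] at h
  exact h.trans card_algEquiv_dvd_three

/-- **`|Aut R(f)| = 1` or `3`** for every order `R(f)` in a cubic field (BTT (29) for the maximal
order). [cite: BhargavaTaniguchiThorne2023, §4.1 (29) (|Aut F| = 1 or 3 for a cubic field)] -/
theorem card_ringAut_eq_one_or_three : Nat.card (RingAut (RingOfForm f)) = 1 ∨ Nat.card (RingAut (RingOfForm f)) = 3 :=
  (Nat.dvd_prime Nat.prime_three).mp card_ringAut_dvd_three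

end RingOfForm

open RingOfForm

variable {f : BinaryCubic ℤ} [hf : Fact f.IsIrreducible]

/-- **`|Stab_{GL₂(ℤ)}(f)| = 1` or `3`** for irreducible `f`: the Shintani weight of an irreducible
orbit is `1` or `1/3`. [cite: BhargavaTaniguchiThorne2023, §4.1 (29) (|Aut| = 1 or 3 in the cubic field case)] -/
theorem card_stabilizer_eq_one_or_three :
    Nat.card (MulAction.stabilizer (GL (Fin 2) ℤ) f) = 1 ∨ Nat.card (MulAction.stabilizer (GL (Fin 2) ℤ) f) = 3 := by
  rw [card_stabilizer_eq_card_ringAut]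
  exact card_ringAut_eq_one_or_three

/-- In particular `|Stab(f)| ≠ 2` for irreducible `f` (contrast `|Stab| = 2` for `ℤ × 𝓞_F`). [folklore] -/
theorem card_stabilizer_ne_two : Nat.card (MulAction.stabilizer (GL (Fin 2) ℤ) f) ≠ 2 := by
  rcases card_stabilizer_eq_one_or_three (f := f) with h | h <;> omega

end Literature.NumberTheory.CubicFields
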